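import Summits.QuantumFields.YangMills.Theorems.BalabanUVNodesPortZDStepLaw
import Mathlib.Analysis.Calculus.ParametricIntegral
import Mathlib.Analysis.SpecialFunctions.Log.Deriv

/-!
# NODE O port, row PT-A′ helper lane (PTZ-1, gen 3): THE LINEAR RESPONSE OF THE STEP — the real history pencil `t ↦ R_k(A + t·E)(W)` (gen 0: ends `𝓝⁰_{k+1}` at `t = 0`,
# `𝓝_{k+1}` at `t = 1`) is DIFFERENTIABLE AT `t = 0` with derivative THE FIRST-ORDER PERTURBATIVE VALUE of `…PortZDStepLaw`: the fibre expectation of print's curly bracket at `W`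
# minus at `1` (minus the unit value `E(bg_1)`) — generic over `Node00/ZeroInputStepT`; fibre laws DISPLAYED through their defining identity

[Balaban1987RG1] = [I] (CMP 109, 1987): (0.19) p. 255–256, (1.6) p. 261, (2.12)–(2.14) p. 268; [Balaban1988RG2Cluster] = [II] (CMP 116, 1988): (1.9) p. 4 («as in cluster expansions, we
apply the fundamental theorem of calculus»), p. 21.

Seat `ymgap-nodeO-port-PTZ-1` g3 (prover, HELPER MODE; `--supports stmt-QuantumFields-27930 --as helper`).  Generic layer (0 tokens of the χ-cone of record); CRIT-1 Q-5 (β).  Companion of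
this seat's `…PortZDStepRows` (gen 0 ✓p797663: the pencil ends `stepOutT_main_add_one_smul ∕ _zero_smul`), `…PortZDHistoryFluctuation` (✓p805483: the log-moment identity) and
`…PortZDStepLaw` (✓p807160: the fibre-law interface `hμ : ∀ f, ∫ f dμ = T(f·I(A))(V) ∕ T(I(A))(V)`, the moment identity, the first-order term).  The lens seat's (L♭) route
(`…PortZDSchwarz`) reads the same pencil in a COMPLEX multiplier; this file is its real-axis first derivative at the origin.

WHAT IS PROVED (0 sorry; no `def` ∕ `instance` ∕ `notation`):
* §1 generic (probability space, `|F| ≤ M` a.e., `F` a.e.-strongly measurable): `integrable_exp_mul_of_ae_bound` (`e^{tF} ∈ L¹` for every `t`), ★ `hasDerivAt_integral_exp_mul_of_ae_bound`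
  (`t ↦ ∫ e^{tF} dμ` has derivative `∫ F e^{tF} dμ` at every `t` — dominated differentiation, Mathlib `hasDerivAt_integral_of_dominated_loc_of_deriv_le`),
  ★ `hasDerivAt_log_integral_exp_mul_zero` (`t ↦ log ∫ e^{tF} dμ` has derivative `∫ F dμ` at `t = 0`).
* §2 ★ `hasDerivAt_log_moment_zero_of_stepLaw` — under the fibre-law identity at `(A, V)` and `T(I(A))(V) ≠ 0`: `t ↦ log[T(I(A + t·F))(V) ∕ T(I(A))(V)]` has derivative `∫ F dμ` at `0`.
* §3 ★★ `hasDerivAt_stepOutT_pencil_zero` — for `T K k` degree-one homogeneous, fibre laws `μW`, `μ1` of the `A`-step at `W` and `1`, the `A`-step defined at `W`, `1`, and the brackets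
  `E − E(bg_W)`, `E − E(bg_1)` a.e.-bounded: `HasDerivAt (t ↦ R_k(A + t·E)(W)) (⟨E − E(bg_W)⟩_{μW} − ⟨E − E(bg_1)⟩_{μ1} − E(bg_1)) 0`;
  ★★ `hasDerivAt_dChannel_pencil_zero` — the instance `A := A⁰_k`, `E := 𝐄_k` (gen 0's pencil: `t = 0` end `𝓝⁰_{k+1}(W)`, `t = 1` end `𝓝_{k+1}(W)`): its slope at the zero-input end is
  `⟨𝐄_k − 𝐄_k(bg_W)⟩⁰_W − ⟨𝐄_k − 𝐄_k(bg_1)⟩⁰_1 − 𝐄_k(bg_1)` — THE FIRST-ORDER PERTURBATIVE VALUE of `…PortZDStepLaw.abs_dChannel_sub_firstOrder_le_var` IS THE LINEAR RESPONSE OF THE STEP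
  TO THE HISTORY; `hasDerivAt_dChannel_pencil_zero_of_gaugeInvariant` — with `GaugeInvariant A_k` (unit normalisation) the last term is `0`.

HONEST FRAMING.  Calculus bookkeeping (dominated differentiation, `HasDerivAt.log`) over the tree's definitions; fibre laws, positivity, bounds and `GaugeInvariant A_k` are HYPOTHESES
displayed by name; NOTHING of Bałaban's estimates asserted, ported or discharged; no named fact introduced; 26648 ∕ 27930⁸ SIGNED·OPEN (content-gated), 27931 OPEN (RC-3), 27932 CLOSED;
K0⁷ ∕ K-Ax OPEN; counts unmoved; finite 𝕋⁴ at fixed ε — NOT continuum ∕ OS ∕ Clay; the Yang–Mills mass gap is NOT proved by any of this.  No `sorry`, no `instance`, no `notation`, no `def`.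
-/

noncomputable section

open MeasureTheory

namespace Summit.QuantumFields.YangMills.Theorems.PortZD

open Literature.MathematicalPhysics.QuantumFieldTheory.Balaban1983to89
open Literature.MathematicalPhysics.QuantumFieldTheory.Balaban1983to89.Node00
open Literature.MathematicalPhysics.QuantumFieldTheory.Balaban1983to89.Node00.ZeroInput
open T4Continuum (T4Family)
open B12Eq019ActionBody (nextAction normConst integrand integrand_apply)
open GaugeField (GaugeInvariant)

/-! ## §1. Dominated differentiation of `t ↦ ∫ e^{tF} dμ` for an a.e.-bounded `F` on a probability space -/

section Generic

variable {X : Type*} [MeasurableSpace X] {μ : Measure X} [IsProbabilityMeasure μ] {F : X → ℝ} {M : ℝ}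

/-- `e^{tF}` is integrable for every real `t` when `|F| ≤ M` a.e. (bounded by `e^{|t|M}`). [cite: Balaban1988RG2Cluster, p.21 (bookkeeping)] -/
theorem integrable_exp_mul_of_ae_bound (hFm : AEStronglyMeasurable F μ) (hb : ∀ᵐ x ∂μ, |F x| ≤ M) (t : ℝ) :
    Integrable (fun x => Real.exp (t * F x)) μ := by
  refine Integrable.mono' (integrable_const (Real.exp (|t| * M))) (Real.continuous_exp.comp_aestronglyMeasurable (hFm.const_mul t)) ?_
  filter_upwards [hb] with x hx
  rw [Real.norm_eq_abs, abs_of_pos (Real.exp_pos _)]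
  refine Real.exp_le_exp.2 ?_
  calc t * F x ≤ |t * F x| := le_abs_self _
    _ = |t| * |F x| := abs_mul _ _
    _ ≤ |t| * M := mul_le_mul_of_nonneg_left hx (abs_nonneg _)

/-- ★ **`t ↦ ∫ e^{tF} dμ` HAS DERIVATIVE `∫ F·e^{tF} dμ` AT EVERY `t`** (dominated differentiation on the ball of radius `1`: `|F e^{sF}| ≤ M e^{(|t|+1)M}` a.e.).
[cite: Balaban1988RG2Cluster, (1.9) p.4 (bookkeeping: FTC ∕ differentiation in the multiplier)] -/
theorem hasDerivAt_integral_exp_mul_of_ae_bound (hFm : AEStronglyMeasurable F μ) (hb : ∀ᵐ x ∂μ, |F x| ≤ M) (t : ℝ) :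
    HasDerivAt (fun s => ∫ x, Real.exp (s * F x) ∂μ) (∫ x, F x * Real.exp (t * F x) ∂μ) t := by
  have hM : 0 ≤ M := by
    obtain ⟨x, hx⟩ := hb.exists
    exact (abs_nonneg _).trans hx
  have h := hasDerivAt_integral_of_dominated_loc_of_deriv_le (μ := μ) (F := fun s x => Real.exp (s * F x))
    (F' := fun s x => F x * Real.exp (s * F x)) (x₀ := t) (bound := fun _ => M * Real.exp ((|t| + 1) * M)) (s := Metric.ball t 1)
    (Metric.ball_mem_nhds t one_pos)
    (Filter.Eventually.of_forall fun s => Real.continuous_exp.comp_aestronglyMeasurable (hFm.const_mul s))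
    (integrable_exp_mul_of_ae_bound hFm hb t)
    (hFm.mul (Real.continuous_exp.comp_aestronglyMeasurable (hFm.const_mul t)))
    (by
      filter_upwards [hb] with x hx s hs
      rw [Metric.mem_ball, Real.dist_eq] at hs
      rw [Real.norm_eq_abs, abs_mul, abs_of_pos (Real.exp_pos _)]
      refine mul_le_mul hx (Real.exp_le_exp.2 ?_) (Real.exp_pos _).le hM
      have hs' : |s| ≤ |t| + 1 := by
        have h1 := abs_sub_abs_le_abs_sub s t
        linarith
      calc s * F x ≤ |s * F x| := le_abs_self _
        _ = |s| * |F x| := abs_mul _ _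
        _ ≤ (|t| + 1) * M := mul_le_mul hs' hx (abs_nonneg _) (by positivity))
    (integrable_const _)
    (Filter.Eventually.of_forall fun x s _ => by
      have h := (Real.hasDerivAt_exp (s * F x)).comp s (hasDerivAt_mul_const (F x))
      have h' : HasDerivAt (fun s => Real.exp (s * F x)) (Real.exp (s * F x) * F x) s := h
      rw [mul_comm] at h'
      exact h')
  exact h.2

/-- ★ **`t ↦ log ∫ e^{tF} dμ` HAS DERIVATIVE `∫ F dμ` AT `t = 0`** (the cumulant generating function's slope at the origin is the mean).
[cite: Balaban1988RG2Cluster, (1.9) p.4, p.21 (bookkeeping)] -/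
theorem hasDerivAt_log_integral_exp_mul_zero (hFm : AEStronglyMeasurable F μ) (hb : ∀ᵐ x ∂μ, |F x| ≤ M) :
    HasDerivAt (fun s => Real.log (∫ x, Real.exp (s * F x) ∂μ)) (∫ x, F x ∂μ) 0 := by
  have h := hasDerivAt_integral_exp_mul_of_ae_bound hFm hb 0
  have h0 : ∫ x, Real.exp (0 * F x) ∂μ = 1 := by simp
  have h1 : ∫ x, F x * Real.exp (0 * F x) ∂μ = ∫ x, F x ∂μ := by simp
  rw [h1] at h
  have hl := h.log (by rw [h0]; exact one_ne_zero)
  rw [h0, div_one] at hl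
  exact hl

end Generic

/-! ## §2. The log-moment of the `A`-step has slope `⟨F⟩_μ` at the origin of the multiplier -/

section StepLaw

variable {P : Params} {G : Type*} {k : ℕ} [MeasurableSpace (GaugeField P k G)]

/-- ★ Under the fibre-law identity at `(A, V)` with `T(I(A))(V) ≠ 0` and an a.e.-bounded bracket `F`: `t ↦ log[T(I(A + t·F))(V) ∕ T(I(A))(V)]` has derivative `∫ F dμ` at `0`.
[cite: Balaban1987RG1, (2.12)–(2.14) p.268; Balaban1988RG2Cluster, p.21 (bookkeeping)] -/
theorem hasDerivAt_log_moment_zero_of_stepLaw {T : Density P k G → Density P (k + 1) G} {χ GF : Density P k G} {gk : ℝ} {A : Density P k G}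
    {V : GaugeField P (k + 1) G} {μ : Measure (GaugeField P k G)}
    (hμ : ∀ f : Density P k G, ∫ U, f U ∂μ = T (fun U => f U * integrand χ GF gk A U) V / T (integrand χ GF gk A) V)
    (hZ : T (integrand χ GF gk A) V ≠ 0) (F : Density P k G) {M : ℝ} (hFm : AEStronglyMeasurable F μ) (hb : ∀ᵐ U ∂μ, |F U| ≤ M) :
    HasDerivAt (fun t : ℝ => Real.log (T (integrand χ GF gk (A + t • F)) V / T (integrand χ GF gk A) V)) (∫ U, F U ∂μ) 0 := by
  haveI := isProbabilityMeasure_of_stepLaw hμ hZ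
  have hfun : (fun t : ℝ => Real.log (T (integrand χ GF gk (A + t • F)) V / T (integrand χ GF gk A) V)) =
      fun t => Real.log (∫ U, Real.exp (t * F U) ∂μ) := by
    funext t
    rw [moment_eq_integral_exp_of_stepLaw hμ (t • F)]
    simp only [Pi.smul_apply, smul_eq_mul]
  rw [hfun]
  exact hasDerivAt_log_integral_exp_mul_zero hFm hb

end StepLaw

/-! ## §3. The linear response of the step functional and of the history channel -/

variable (F : T4Family) (N : ℕ) [NeZero N]

/-- ★★ **THE HISTORY PENCIL IS DIFFERENTIABLE AT THE ZERO END, WITH SLOPE THE FIRST-ORDER PERTURBATIVE VALUE**: `T K k` degree-one homogeneous; fibre laws `μW`, `μ1` of the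
`A`-step at `W` and `1` (displayed); the `A`-step defined at `W`, `1`; the brackets `E − E(bg_W)`, `E − E(bg_1)` a.e.-bounded and a.e.-strongly measurable.  Then
`HasDerivAt (t ↦ R_k(A + t·E)(W)) (⟨E − E(bg_W)⟩_{μW} − ⟨E − E(bg_1)⟩_{μ1} − E(bg_1)) 0`. [cite: Balaban1987RG1, (1.6) p.261, (2.12)–(2.14) p.268; Balaban1988RG2Cluster, (1.9) p.4, p.21] -/
theorem hasDerivAt_stepOutT_pencil_zero (T : Transport F N) (χ : (K : ℕ) → (ℕ → ℝ) → (k : ℕ) → Density (F.P K) k (SU N)) (ε : ℝ) (K : ℕ)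
    (g : ℕ → ℝ) (k : ℕ) (hT : ∀ (a : ℝ) (ρ : Density (F.P K) k (SU N)), T K k (fun U => a * ρ U) = fun V => a * T K k ρ V)
    (A E : Density (F.P K) k (SU N)) (W : GaugeField (F.P K) (k + 1) (SU N)) {μW μ1 : Measure (GaugeField (F.P K) k (SU N))}
    (hμW : ∀ f : Density (F.P K) k (SU N),
      ∫ U, f U ∂μW = T K k (fun U => f U * integrand (χ K g k) (gfOfRecord F N K k) (g k) A U) W / T K k (integrand (χ K g k) (gfOfRecord F N K k) (g k) A) W)
    (hμ1 : ∀ f : Density (F.P K) k (SU N),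
      ∫ U, f U ∂μ1 = T K k (fun U => f U * integrand (χ K g k) (gfOfRecord F N K k) (g k) A U) 1 / T K k (integrand (χ K g k) (gfOfRecord F N K k) (g k) A) 1)
    (hAW : 0 < T K k (integrand (χ K g k) (gfOfRecord F N K k) (g k) A) W)
    (hA1 : 0 < T K k (integrand (χ K g k) (gfOfRecord F N K k) (g k) A) 1) {MW M1 : ℝ}
    (hmW : AEStronglyMeasurable (fun U => E U - E (Averaging.iter (avOfRecord F N K) k (Uk F N K (k + 1) ε W))) μW)
    (hm1 : AEStronglyMeasurable (fun U => E U - E (Averaging.iter (avOfRecord F N K) k (Uk F N K (k + 1) ε 1))) μ1)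
    (hbW : ∀ᵐ U ∂μW, |E U - E (Averaging.iter (avOfRecord F N K) k (Uk F N K (k + 1) ε W))| ≤ MW)
    (hb1 : ∀ᵐ U ∂μ1, |E U - E (Averaging.iter (avOfRecord F N K) k (Uk F N K (k + 1) ε 1))| ≤ M1) :
    HasDerivAt (fun t : ℝ => stepOutT F N T χ ε K g k (A + t • E) W)
      ((∫ U, (E U - E (Averaging.iter (avOfRecord F N K) k (Uk F N K (k + 1) ε W))) ∂μW) -
        (∫ U, (E U - E (Averaging.iter (avOfRecord F N K) k (Uk F N K (k + 1) ε 1))) ∂μ1) -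
        E (Averaging.iter (avOfRecord F N K) k (Uk F N K (k + 1) ε 1))) 0 := by
  set cW := E (Averaging.iter (avOfRecord F N K) k (Uk F N K (k + 1) ε W)) with hcW
  set c1 := E (Averaging.iter (avOfRecord F N K) k (Uk F N K (k + 1) ε 1)) with hc1
  haveI := isProbabilityMeasure_of_stepLaw hμW hAW.ne'
  haveI := isProbabilityMeasure_of_stepLaw hμ1 hA1.ne'
  -- the pencil, for EVERY `t`, is `R(A)(W) + log-moment_W(t·F_W) − log-moment_1(t·F_1) − t·E(bg_1)`
  have hpt : ∀ t : ℝ, stepOutT F N T χ ε K g k (A + t • E) W = stepOutT F N T χ ε K g k A W +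
      (Real.log (T K k (integrand (χ K g k) (gfOfRecord F N K k) (g k) (A + t • fun U => E U - cW)) W /
          T K k (integrand (χ K g k) (gfOfRecord F N K k) (g k) A) W) -
        Real.log (T K k (integrand (χ K g k) (gfOfRecord F N K k) (g k) (A + t • fun U => E U - c1)) 1 /
          T K k (integrand (χ K g k) (gfOfRecord F N K k) (g k) A) 1) - t * c1) := by
    intro t
    have hsW : (fun U => (t • E) U - (t • E) (Averaging.iter (avOfRecord F N K) k (Uk F N K (k + 1) ε W))) = t • fun U => E U - cW := by
      funext U; simp only [Pi.smul_apply, smul_eq_mul, hcW]; ring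
    have hs1 : (fun U => (t • E) U - (t • E) (Averaging.iter (avOfRecord F N K) k (Uk F N K (k + 1) ε 1))) = t • fun U => E U - c1 := by
      funext U; simp only [Pi.smul_apply, smul_eq_mul, hc1]; ring
    -- the `(A + tE)`-steps are defined at `W` and `1`
    have hXW : 0 < T K k (integrand (χ K g k) (gfOfRecord F N K k) (g k) (A + t • fun U => E U - cW)) W :=
      transport_integrand_add_pos_of_stepLaw hμW hAW _ (by
        simpa only [Pi.smul_apply, smul_eq_mul] using integrable_exp_mul_of_ae_bound hmW hbW t)
    have hX1 : 0 < T K k (integrand (χ K g k) (gfOfRecord F N K k) (g k) (A + t • fun U => E U - c1)) 1 :=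
      transport_integrand_add_pos_of_stepLaw hμ1 hA1 _ (by
        simpa only [Pi.smul_apply, smul_eq_mul] using integrable_exp_mul_of_ae_bound hm1 hb1 t)
    have hEW : 0 < T K k (integrand (χ K g k) (gfOfRecord F N K k) (g k) (A + t • E)) W := by
      rw [transport_integrand_add_recentre hT _ _ _ A (t • E) (t * cW) W]
      have : (A + fun U => (t • E) U - t * cW) = A + t • fun U => E U - cW := by
        funext U; simp only [Pi.add_apply, Pi.smul_apply, smul_eq_mul]; ring
      rw [this]; exact mul_pos (Real.exp_pos _) hXW
    have hE1 : 0 < T K k (integrand (χ K g k) (gfOfRecord F N K k) (g k) (A + t • E)) 1 := by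
      rw [transport_integrand_add_recentre hT _ _ _ A (t • E) (t * c1) 1]
      have : (A + fun U => (t • E) U - t * c1) = A + t • fun U => E U - c1 := by
        funext U; simp only [Pi.add_apply, Pi.smul_apply, smul_eq_mul]; ring
      rw [this]; exact mul_pos (Real.exp_pos _) hX1
    have h := stepOutT_add_sub_eq_log_fluct F N T χ ε K g k hT A (t • E) W hAW hA1 hEW hE1
    rw [hsW, hs1] at h
    have h' : (t • E) (Averaging.iter (avOfRecord F N K) k (Uk F N K (k + 1) ε 1)) = t * c1 := by
      simp only [Pi.smul_apply, smul_eq_mul, hc1]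
    rw [h'] at h
    linarith
  have hfun : (fun t : ℝ => stepOutT F N T χ ε K g k (A + t • E) W) = fun t => stepOutT F N T χ ε K g k A W +
      (Real.log (T K k (integrand (χ K g k) (gfOfRecord F N K k) (g k) (A + t • fun U => E U - cW)) W /
          T K k (integrand (χ K g k) (gfOfRecord F N K k) (g k) A) W) -
        Real.log (T K k (integrand (χ K g k) (gfOfRecord F N K k) (g k) (A + t • fun U => E U - c1)) 1 /
          T K k (integrand (χ K g k) (gfOfRecord F N K k) (g k) A) 1) - t * c1) := funext hpt
  rw [hfun]
  have hDW := hasDerivAt_log_moment_zero_of_stepLaw hμW hAW.ne' (fun U => E U - cW) hmW hbW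
  have hD1 := hasDerivAt_log_moment_zero_of_stepLaw hμ1 hA1.ne' (fun U => E U - c1) hm1 hb1
  have hlin : HasDerivAt (fun t : ℝ => t * c1) c1 0 := by simpa using hasDerivAt_mul_const (x := (0 : ℝ)) c1
  exact ((hDW.sub hD1).sub hlin).const_add _

/-- ★★ **THE SLOPE OF gen 0's HISTORY PENCIL AT ITS ZERO-INPUT END IS THE FIRST-ORDER PERTURBATIVE VALUE**: with `A := A⁰_k`, `E := 𝐄_k` (`t = 0` end `𝓝⁰_{k+1}(W)`, `t = 1` end
`𝓝_{k+1}(W)`, `PortZD.stepOutT_main_add_zero_smul ∕ _one_smul`): `HasDerivAt (t ↦ R_k(A⁰_k + t·𝐄_k)(W)) (⟨𝐄_k − 𝐄_k(bg_W)⟩⁰_W − ⟨𝐄_k − 𝐄_k(bg_1)⟩⁰_1 − 𝐄_k(bg_1)) 0` (fibre laws of the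
ZERO-INPUT step, positivity, bounds displayed). [cite: Balaban1987RG1, (0.22) p.256, (1.6) p.261, (2.12)–(2.14) p.268; Balaban1988RG2Cluster, (1.9) p.4, p.21] -/
theorem hasDerivAt_dChannel_pencil_zero (T : Transport F N) (χ : (K : ℕ) → (ℕ → ℝ) → (k : ℕ) → Density (F.P K) k (SU N)) (ε : ℝ) (K : ℕ)
    (g : ℕ → ℝ) (k : ℕ) (hT : ∀ (a : ℝ) (ρ : Density (F.P K) k (SU N)), T K k (fun U => a * ρ U) = fun V => a * T K k ρ V)
    (W : GaugeField (F.P K) (k + 1) (SU N)) {μW μ1 : Measure (GaugeField (F.P K) k (SU N))}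
    (hμW : ∀ f : Density (F.P K) k (SU N),
      ∫ U, f U ∂μW = T K k (fun U => f U * integrand (χ K g k) (gfOfRecord F N K k) (g k) (mainTermT F N ε K g k) U) W /
        T K k (integrand (χ K g k) (gfOfRecord F N K k) (g k) (mainTermT F N ε K g k)) W)
    (hμ1 : ∀ f : Density (F.P K) k (SU N),
      ∫ U, f U ∂μ1 = T K k (fun U => f U * integrand (χ K g k) (gfOfRecord F N K k) (g k) (mainTermT F N ε K g k) U) 1 /
        T K k (integrand (χ K g k) (gfOfRecord F N K k) (g k) (mainTermT F N ε K g k)) 1)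
    (h0W : 0 < T K k (integrand (χ K g k) (gfOfRecord F N K k) (g k) (mainTermT F N ε K g k)) W)
    (h01 : 0 < T K k (integrand (χ K g k) (gfOfRecord F N K k) (g k) (mainTermT F N ε K g k)) 1) {MW M1 : ℝ}
    (hmW : AEStronglyMeasurable (fun U => EkT F N T χ ε K g k U - EkT F N T χ ε K g k (Averaging.iter (avOfRecord F N K) k (Uk F N K (k + 1) ε W))) μW)
    (hm1 : AEStronglyMeasurable (fun U => EkT F N T χ ε K g k U - EkT F N T χ ε K g k (Averaging.iter (avOfRecord F N K) k (Uk F N K (k + 1) ε 1))) μ1)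
    (hbW : ∀ᵐ U ∂μW, |EkT F N T χ ε K g k U - EkT F N T χ ε K g k (Averaging.iter (avOfRecord F N K) k (Uk F N K (k + 1) ε W))| ≤ MW)
    (hb1 : ∀ᵐ U ∂μ1, |EkT F N T χ ε K g k U - EkT F N T χ ε K g k (Averaging.iter (avOfRecord F N K) k (Uk F N K (k + 1) ε 1))| ≤ M1) :
    HasDerivAt (fun t : ℝ => stepOutT F N T χ ε K g k (mainTermT F N ε K g k + t • EkT F N T χ ε K g k) W)
      ((∫ U, (EkT F N T χ ε K g k U - EkT F N T χ ε K g k (Averaging.iter (avOfRecord F N K) k (Uk F N K (k + 1) ε W))) ∂μW) -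
        (∫ U, (EkT F N T χ ε K g k U - EkT F N T χ ε K g k (Averaging.iter (avOfRecord F N K) k (Uk F N K (k + 1) ε 1))) ∂μ1) -
        EkT F N T χ ε K g k (Averaging.iter (avOfRecord F N K) k (Uk F N K (k + 1) ε 1))) 0 :=
  hasDerivAt_stepOutT_pencil_zero F N T χ ε K g k hT _ _ W hμW hμ1 h0W h01 hmW hm1 hbW hb1

/-- The same with the unit normalisation `𝐄_k(Ū^k U_{k+1}(1)) = 0` (`GaugeInvariant A_k` displayed, `ε > 0`, `k + 1 ≤ m + K`): slope `⟨𝐄_k − 𝐄_k(bg_W)⟩⁰_W − ⟨𝐄_k⟩⁰_1`.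
[cite: Balaban1987RG1, (1.6) p.261, (2.12)–(2.14) p.268, (2.16) p.269] -/
theorem hasDerivAt_dChannel_pencil_zero_of_gaugeInvariant (T : Transport F N) (χ : (K : ℕ) → (ℕ → ℝ) → (k : ℕ) → Density (F.P K) k (SU N)) {ε : ℝ}
    (hε : 0 < ε) {K : ℕ} (g : ℕ → ℝ) {k : ℕ} (hk : k + 1 ≤ (F.P K).m + (F.P K).K)
    (hT : ∀ (a : ℝ) (ρ : Density (F.P K) k (SU N)), T K k (fun U => a * ρ U) = fun V => a * T K k ρ V)
    (hinv : GaugeInvariant (effActionHT F N T χ K g k)) (W : GaugeField (F.P K) (k + 1) (SU N)) {μW μ1 : Measure (GaugeField (F.P K) k (SU N))}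
    (hμW : ∀ f : Density (F.P K) k (SU N),
      ∫ U, f U ∂μW = T K k (fun U => f U * integrand (χ K g k) (gfOfRecord F N K k) (g k) (mainTermT F N ε K g k) U) W /
        T K k (integrand (χ K g k) (gfOfRecord F N K k) (g k) (mainTermT F N ε K g k)) W)
    (hμ1 : ∀ f : Density (F.P K) k (SU N),
      ∫ U, f U ∂μ1 = T K k (fun U => f U * integrand (χ K g k) (gfOfRecord F N K k) (g k) (mainTermT F N ε K g k) U) 1 /
        T K k (integrand (χ K g k) (gfOfRecord F N K k) (g k) (mainTermT F N ε K g k)) 1)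
    (h0W : 0 < T K k (integrand (χ K g k) (gfOfRecord F N K k) (g k) (mainTermT F N ε K g k)) W)
    (h01 : 0 < T K k (integrand (χ K g k) (gfOfRecord F N K k) (g k) (mainTermT F N ε K g k)) 1) {MW M1 : ℝ}
    (hmW : AEStronglyMeasurable (fun U => EkT F N T χ ε K g k U - EkT F N T χ ε K g k (Averaging.iter (avOfRecord F N K) k (Uk F N K (k + 1) ε W))) μW)
    (hm1 : AEStronglyMeasurable (EkT F N T χ ε K g k) μ1)
    (hbW : ∀ᵐ U ∂μW, |EkT F N T χ ε K g k U - EkT F N T χ ε K g k (Averaging.iter (avOfRecord F N K) k (Uk F N K (k + 1) ε W))| ≤ MW)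
    (hb1 : ∀ᵐ U ∂μ1, |EkT F N T χ ε K g k U| ≤ M1) :
    HasDerivAt (fun t : ℝ => stepOutT F N T χ ε K g k (mainTermT F N ε K g k + t • EkT F N T χ ε K g k) W)
      ((∫ U, (EkT F N T χ ε K g k U - EkT F N T χ ε K g k (Averaging.iter (avOfRecord F N K) k (Uk F N K (k + 1) ε W))) ∂μW) -
        ∫ U, EkT F N T χ ε K g k U ∂μ1) 0 := by
  have h0 := EkT_iter_Uk_one_of_gaugeInvariant F N T χ hε g hk hinv
  have h := hasDerivAt_dChannel_pencil_zero F N T χ ε K g k hT W hμW hμ1 h0W h01 hmW (by simpa only [h0, sub_zero] using hm1) hbW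
    (by simpa only [h0, sub_zero] using hb1)
  simpa only [h0, sub_zero] using h

end Summit.QuantumFields.YangMills.Theorems.PortZD

end
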